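/-
Copyright (c) 2026. All rights reserved.
Released under Apache 2.0 license as described in the file LICENSE.
Authors: abc-iut cell, prover seat abc-iut-L4-t12 (gen 7).
-/
import Literature.AnabelianGeometry.AbsoluteAnabelian.ArchimedeanHolFieldFunctorGeometric
import Literature.Geometry.Kaehler.RiemannSurfaceStructurePullbackRigidity
import Literature.Topology.CoveringSpaces.PathComponentCovering
import HarnessLib

/-!
# [AbsTopIII] §4: objects of `HolRS` over a fixed Riemann surface = its connected finite coverings

PROOF-ONLY junction file (abc-iut cell, campaign-L item R1.2 of the geometric `EA` column of
[AbsTopIII] Prop 4.2 / Cor 4.5; classical).  S. Mochizuki, *Topics in Absolute Anabelian Geometry III*,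
proof of Prop 4.2, kurims p.106 l.11–19:

> To verify the id-rigidity of `EA`, it suffices to observe that for any object `X ∈ Ob(EA)` … the
> full subcategory of `EA` consisting of objects that map to `X` may, by Corollary 2.3, (i) …, be
> identified with the category of finite étale R-localizations "`Loc_R(X)`" …

For abc-iut-L4-t14's geometric model `HolRS` of `EA`/`TH` (connected Hausdorff Riemann surfaces with
holomorphic finite étale maps, `ArchimedeanHolFieldFunctorGeometric.lean`, Def 4.1 (i)/(iii)) this
identification of «objects that map to `X`» with the TOPOLOGICAL finite coverings of `X` is the
classical induced-structure theorem, I-Hsiung Lin, *Classical complex analysis* vol. 2 (2011),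
(7.5.2.1) p.449 (the tree's `Literature/Geometry/Kaehler/RiemannSurfaceStructurePullback(Rigidity)`:
a local homeomorphism into a Riemann surface induces a unique complex structure, for which maps over
the base are holomorphic).  We prove, for `𝕏 : HolRS`:

* `isLocalDiffeomorph_of_mdifferentiable_of_isLocalHomeomorph`, `HolRS.Hom.isLocalDiffeomorph` — a
  holomorphic local homeomorphism of Riemann surfaces (in particular every morphism of `HolRS`) is a
  local biholomorphism (local `C^ω`-diffeomorphism), by the tree's holomorphic inverse function theorem
  `mdifferentiableAt_symm_of_mdifferentiable`;
* `HolRS.mdifferentiable_of_comp_eq`, `HolRS.homOfOver`, `HolRS.isoOfHomeomorphOver` — **RIGIDITY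
  (full faithfulness on the nose)**: for `𝕐 → 𝕏 ← ℤ` in `HolRS`, every CONTINUOUS map
  `g : 𝕐 → ℤ` over `𝕏` is holomorphic; if it is finite étale it is a morphism of `HolRS`, and a
  homeomorphism over `𝕏` is an isomorphism of `HolRS`;
* `HolRS.ofCover`, `HolRS.ofCoverHom` — **ESSENTIAL SURJECTIVITY**: a connected topological space `E`
  with a finite covering map `p : E → 𝕏` IS an object of `HolRS` over `𝕏` (Hausdorff as a covering of
  a Hausdorff space; Riemann-surface structure pulled back along `p`; `p` holomorphic finite étale);
* `HolRS.ofCoverIso` — **UNIQUENESS**: any object `𝕐 → 𝕏` of `HolRS` whose underlying space is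
  homeomorphic to `E` over `𝕏` is isomorphic in `HolRS` to `HolRS.ofCover`.

So the SLICE category of `HolRS` over `𝕏` (objects over `𝕏`, morphisms OVER `𝕏`) has, up to
isomorphism, exactly the connected finite covering spaces of `𝕏^top` as objects and the continuous
maps over `𝕏^top` as morphisms — the dictionary under which the cell's topological Galois
correspondence for covers (R1 step 1, `Literature/Topology/CoveringSpaces/CoveringMapFibreFunctor.lean`
ff., `CovFin`) applies.  CAVEAT (print's wording): «the full subcategory of `EA` consisting of objects
that map to `X`» has the same objects but ALL finite étale morphisms between them, not only those over
`X` (whence print's `Loc_R(X)` and Lemma 4.3); the not-over-`X` morphisms are the subject of the tree's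
`LocCategoryGroupModel.lean` (abc-iut-L4-t14), not of this file.  HONEST SCOPE: classical complex
analysis about OUR model category `HolRS`; the orbicurve objects of print's `EA`, uniformisation and the
slimness input (Lemma 4.3) are not touched; nothing here bears on [IUTchIII] Cor. 3.12.  No new
definitions of mathematical content (three packaging `def`s: a morphism, an isomorphism, an object of
`HolRS`); no instances, no Prop facts.

## References

* S. Mochizuki, *Topics in Absolute Anabelian Geometry III*, kurims ms, Def 4.1 (i) p.101, (iii) p.103;
  proof of Prop 4.2 p.106 l.11–19. [MochizukiAbsTopIII2015]
* I-Hsiung Lin, *Classical complex analysis: a geometric approach*, vol. 2, World Scientific (2011),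
  (7.5.2.1) p.449. [Lin2011]
-/

noncomputable section

open Set Function Filter Topology CategoryTheory
open scoped Manifold ContDiff Topology
open Literature.Geometry.Kaehler

namespace Literature.AnabelianGeometry.AbsoluteAnabelian

universe u

/-! ### §1 Holomorphic local homeomorphisms of Riemann surfaces are local biholomorphisms -/

section LocalBiholomorphism

variable {M : Type u} [TopologicalSpace M] [ChartedSpace ℂ M] [IsManifold 𝓘(ℂ, ℂ) ω M]
  {N : Type u} [TopologicalSpace N] [ChartedSpace ℂ N] [IsManifold 𝓘(ℂ, ℂ) ω N]

/-- **A holomorphic local homeomorphism between Riemann surfaces is a local biholomorphism** (a local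
`C^ω`-diffeomorphism in Mathlib's sense): each open partial homeomorphism piece of `f` is holomorphic
(given) with holomorphic inverse (the tree's holomorphic inverse function theorem
`mdifferentiableAt_symm_of_mdifferentiable`), and holomorphic maps of complex manifolds are `C^ω`
(`contMDiffOn_of_mdifferentiableOn`).  Lin: «F is then locally conformal».
[cite: Lin2011, (7.5.2.1) p.449] -/
theorem isLocalDiffeomorph_of_mdifferentiable_of_isLocalHomeomorph {f : M → N}
    (hf : MDifferentiable 𝓘(ℂ, ℂ) 𝓘(ℂ, ℂ) f) (hl : IsLocalHomeomorph f) :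
    IsLocalDiffeomorph 𝓘(ℂ, ℂ) 𝓘(ℂ, ℂ) ω f := by
  intro x
  obtain ⟨e, hx, hfe⟩ := hl x
  have hd : ∀ u ∈ e.source, MDifferentiableAt 𝓘(ℂ, ℂ) 𝓘(ℂ, ℂ) e u := fun u _ => hfe ▸ hf u
  refine ⟨{ toPartialEquiv := e.toPartialEquiv
            open_source := e.open_source
            open_target := e.open_target
            contMDiffOn_toFun := ?_
            contMDiffOn_invFun := ?_ }, hx, fun y _ => by rw [hfe]; rfl⟩
  · change ContMDiffOn 𝓘(ℂ, ℂ) 𝓘(ℂ, ℂ) ω e e.source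
    exact contMDiffOn_of_mdifferentiableOn (fun u hu => (hd u hu).mdifferentiableWithinAt) e.open_source
  · change ContMDiffOn 𝓘(ℂ, ℂ) 𝓘(ℂ, ℂ) ω e.symm e.target
    exact contMDiffOn_of_mdifferentiableOn
      (fun y hy => (mdifferentiableAt_symm_of_mdifferentiable e hd hy).mdifferentiableWithinAt)
      e.open_target

end LocalBiholomorphism

namespace HolRS

/-- **Every morphism of `HolRS` is a local biholomorphism** (holomorphic finite étale ⇒ holomorphic
covering map ⇒ holomorphic local homeomorphism). [cite: MochizukiAbsTopIII2015, Definition 4.1 (iii) p.103] -/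
theorem Hom.isLocalDiffeomorph {X Y : HolRS} (f : X ⟶ Y) :
    IsLocalDiffeomorph 𝓘(ℂ, ℂ) 𝓘(ℂ, ℂ) ω f.toFun :=
  isLocalDiffeomorph_of_mdifferentiable_of_isLocalHomeomorph f.mdifferentiable f.isLocalHomeomorph

/-! ### §2 Rigidity: continuous maps over `𝕏` between objects over `𝕏` are morphisms -/

/-- **Rigidity of objects of `HolRS` over a fixed `𝕏`**: for morphisms `f_𝕐 : 𝕐 → 𝕏`, `f_ℤ : ℤ → 𝕏`
of `HolRS`, every continuous map `g : 𝕐 → ℤ` of the underlying spaces with `f_ℤ ∘ g = f_𝕐` is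
holomorphic (Lin (7.5.2.1): maps over the base into a space étale over it are analytic; the tree's
`Literature.Geometry.Kaehler.mdifferentiable_of_comp_eq`).  This is the step that lets «the full
subcategory of objects that map to `X`» be read off the topological coverings of `X`.
[cite: MochizukiAbsTopIII2015, proof of Proposition 4.2, p.106 l.11–19] [cite: Lin2011, (7.5.2.1) p.449] -/
theorem mdifferentiable_of_comp_eq {X Y Z : HolRS} (fY : Y ⟶ X) (fZ : Z ⟶ X)
    {g : Y.carrier → Z.carrier} (hg : Continuous g) (h : fZ.toFun ∘ g = fY.toFun) :
    MDifferentiable 𝓘(ℂ, ℂ) 𝓘(ℂ, ℂ) g :=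
  Literature.Geometry.Kaehler.mdifferentiable_of_comp_eq fY.mdifferentiable fZ.isLocalDiffeomorph hg h

/-- **A continuous finite étale map over `𝕏` between objects of `HolRS` over `𝕏` is a morphism of
`HolRS`** (holomorphy is automatic by rigidity). [cite: MochizukiAbsTopIII2015, proof of Proposition 4.2, p.106 l.11–19]
[cite: Lin2011, (7.5.2.1) p.449] -/
def homOfOver {X Y Z : HolRS} (fY : Y ⟶ X) (fZ : Z ⟶ X) (g : Y.carrier → Z.carrier)
    (hge : IsFiniteEtale g) (h : fZ.toFun ∘ g = fY.toFun) : Y ⟶ Z where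
  toFun := g
  mdifferentiable := mdifferentiable_of_comp_eq fY fZ hge.isCoveringMap.continuous h
  isFiniteEtale := hge

/-- The morphism `homOfOver` is `g` on points. [cite: MochizukiAbsTopIII2015, Definition 4.1 (iii) p.103] -/
@[simp] theorem homOfOver_toFun {X Y Z : HolRS} (fY : Y ⟶ X) (fZ : Z ⟶ X) (g : Y.carrier → Z.carrier)
    (hge : IsFiniteEtale g) (h : fZ.toFun ∘ g = fY.toFun) : (homOfOver fY fZ g hge h).toFun = g :=
  rfl

/-- `homOfOver` is a morphism OVER `𝕏`. [cite: MochizukiAbsTopIII2015, Definition 4.1 (iii) p.103] -/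
theorem homOfOver_comp {X Y Z : HolRS} (fY : Y ⟶ X) (fZ : Z ⟶ X) (g : Y.carrier → Z.carrier)
    (hge : IsFiniteEtale g) (h : fZ.toFun ∘ g = fY.toFun) : homOfOver fY fZ g hge h ≫ fZ = fY :=
  hom_ext (by rw [comp_toFun, homOfOver_toFun, h])

/-- **A homeomorphism over `𝕏` between objects of `HolRS` over `𝕏` is an isomorphism of `HolRS`**
(both directions are continuous finite étale maps over `𝕏`, hence morphisms by rigidity — Lin's
uniqueness clause «id is a global conformal map»).
[cite: MochizukiAbsTopIII2015, proof of Proposition 4.2, p.106 l.11–19] [cite: Lin2011, (7.5.2.1) p.449, proof p.450] -/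
def isoOfHomeomorphOver {X Y Z : HolRS} (fY : Y ⟶ X) (fZ : Z ⟶ X) (e : Y.carrier ≃ₜ Z.carrier)
    (h : fZ.toFun ∘ e = fY.toFun) : Y ≅ Z where
  hom := homOfOver fY fZ e (IsFiniteEtale.of_homeomorph e) h
  inv := homOfOver fZ fY e.symm (IsFiniteEtale.of_homeomorph e.symm) (by
    funext z
    have := congrFun h (e.symm z)
    simp only [comp_apply, Homeomorph.apply_symm_apply] at this
    simpa only [comp_apply] using this.symm)
  hom_inv_id := hom_ext (by
    rw [comp_toFun, homOfOver_toFun, homOfOver_toFun, id_toFun]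
    exact e.symm_comp_self)
  inv_hom_id := hom_ext (by
    rw [comp_toFun, homOfOver_toFun, homOfOver_toFun, id_toFun]
    exact e.self_comp_symm)

/-- The isomorphism `isoOfHomeomorphOver` is `e` on points. [cite: MochizukiAbsTopIII2015, Definition 4.1 (iii) p.103] -/
@[simp] theorem isoOfHomeomorphOver_hom_toFun {X Y Z : HolRS} (fY : Y ⟶ X) (fZ : Z ⟶ X)
    (e : Y.carrier ≃ₜ Z.carrier) (h : fZ.toFun ∘ e = fY.toFun) :
    (isoOfHomeomorphOver fY fZ e h).hom.toFun = e :=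
  rfl

/-- `isoOfHomeomorphOver` is an isomorphism OVER `𝕏`. [cite: MochizukiAbsTopIII2015, Definition 4.1 (iii) p.103] -/
theorem isoOfHomeomorphOver_hom_comp {X Y Z : HolRS} (fY : Y ⟶ X) (fZ : Z ⟶ X)
    (e : Y.carrier ≃ₜ Z.carrier) (h : fZ.toFun ∘ e = fY.toFun) :
    (isoOfHomeomorphOver fY fZ e h).hom ≫ fZ = fY :=
  homOfOver_comp fY fZ e _ h

/-! ### §3 Essential surjectivity: a connected finite covering space of `𝕏` is an object over `𝕏` -/

section OfCover

variable (X : HolRS) {E : Type} [TopologicalSpace E] [ConnectedSpace E] {p : E → X.carrier}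

/-- The total space of a covering of a Hausdorff space is Hausdorff (re-proved here in six lines to
avoid importing the tree's `Literature.Topology.FourManifolds.t2Space_of_isCoveringMap` with its
singular-homology dependencies): points of one fibre are separated because a covering map is separated,
points of distinct fibres by preimages of disjoint neighbourhoods. [folklore] -/
private theorem t2Space_of_isCoveringMap' {E B : Type*} [TopologicalSpace E] [TopologicalSpace B]
    [T2Space B] {p : E → B} (cov : IsCoveringMap p) : T2Space E := by
  refine ⟨fun e₁ e₂ hne => ?_⟩
  by_cases h : p e₁ = p e₂
  · exact cov.isSeparatedMap e₁ e₂ h hne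
  · obtain ⟨u, v, hu, hv, h₁, h₂, huv⟩ := t2_separation h
    exact ⟨p ⁻¹' u, p ⁻¹' v, hu.preimage cov.continuous, hv.preimage cov.continuous, h₁, h₂,
      huv.preimage p⟩

/-- **A connected finite covering space of a connected Riemann surface `𝕏` is an object of `HolRS`**:
Hausdorff (covering of a Hausdorff space), connected (given), with the Riemann-surface structure
induced along `p` (Lin (7.5.2.1): `IsLocalHomeomorph.comapChartedSpace`, `IsCoveringMap.isManifold_comap`).
[cite: Lin2011, (7.5.2.1) p.449] [cite: MochizukiAbsTopIII2015, Definition 4.1 (i) p.101] -/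
def ofCover (hp : IsCoveringMap p) (_hfin : ∀ x, (p ⁻¹' {x}).Finite) : HolRS :=
  letI := IsLocalHomeomorph.comapChartedSpace ℂ hp.isLocalHomeomorph
  haveI := t2Space_of_isCoveringMap' hp
  haveI : IsManifold 𝓘(ℂ, ℂ) ω E := hp.isManifold_comap
  HolRS.mk E

/-- The underlying space of `ofCover` is `E`. [cite: Lin2011, (7.5.2.1) p.449] -/
@[simp] theorem ofCover_carrier (hp : IsCoveringMap p) (hfin : ∀ x, (p ⁻¹' {x}).Finite) :
    (X.ofCover hp hfin).carrier = E :=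
  rfl

/-- **The covering map is a morphism `ofCover → 𝕏` of `HolRS`**: holomorphic for the induced structure
(`IsLocalHomeomorph.mdifferentiable_proj`) and finite étale by hypothesis.
[cite: Lin2011, (7.5.2.1) p.449] [cite: MochizukiAbsTopIII2015, Definition 4.1 (iii) p.103] -/
def ofCoverHom (hp : IsCoveringMap p) (hfin : ∀ x, (p ⁻¹' {x}).Finite) : X.ofCover hp hfin ⟶ X where
  toFun := p
  mdifferentiable := IsLocalHomeomorph.mdifferentiable_proj (n := ω) hp.isLocalHomeomorph (by simp)
  isFiniteEtale := ⟨hp, hfin⟩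

/-- The structure morphism of `ofCover` is `p` on points. [cite: MochizukiAbsTopIII2015, Definition 4.1 (iii) p.103] -/
@[simp] theorem ofCoverHom_toFun (hp : IsCoveringMap p) (hfin : ∀ x, (p ⁻¹' {x}).Finite) :
    (X.ofCoverHom hp hfin).toFun = p :=
  rfl

/-- **The structure morphism of `ofCover` is a local biholomorphism** for the induced structure.
[cite: Lin2011, (7.5.2.1) p.449 («F is then locally conformal»)] -/
theorem ofCoverHom_isLocalDiffeomorph (hp : IsCoveringMap p) (hfin : ∀ x, (p ⁻¹' {x}).Finite) :
    IsLocalDiffeomorph 𝓘(ℂ, ℂ) 𝓘(ℂ, ℂ) ω (X.ofCoverHom hp hfin).toFun :=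
  (X.ofCoverHom hp hfin).isLocalDiffeomorph

/-- **Uniqueness of the structure of an object over `𝕏` with given underlying covering space**: an
object `𝕐 → 𝕏` of `HolRS` whose underlying space is homeomorphic to `E` over `𝕏` is isomorphic, in
`HolRS` and over `𝕏`, to `ofCover` (Lin (7.5.2.1) «unique complex structure»).
[cite: Lin2011, (7.5.2.1) p.449, proof p.450] [cite: MochizukiAbsTopIII2015, proof of Proposition 4.2, p.106 l.11–19] -/
def ofCoverIso (hp : IsCoveringMap p) (hfin : ∀ x, (p ⁻¹' {x}).Finite) {Y : HolRS} (fY : Y ⟶ X)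
    (e : Y.carrier ≃ₜ E) (h : p ∘ e = fY.toFun) : Y ≅ X.ofCover hp hfin :=
  isoOfHomeomorphOver fY (X.ofCoverHom hp hfin) e h

/-- `ofCoverIso` is an isomorphism OVER `𝕏`. [cite: MochizukiAbsTopIII2015, Definition 4.1 (iii) p.103] -/
theorem ofCoverIso_hom_comp (hp : IsCoveringMap p) (hfin : ∀ x, (p ⁻¹' {x}).Finite) {Y : HolRS}
    (fY : Y ⟶ X) (e : Y.carrier ≃ₜ E) (h : p ∘ e = fY.toFun) :
    (X.ofCoverIso hp hfin fY e h).hom ≫ X.ofCoverHom hp hfin = fY :=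
  isoOfHomeomorphOver_hom_comp (Z := X.ofCover hp hfin) fY (X.ofCoverHom hp hfin) e h

/-- **Continuous maps over `𝕏` from any object over `𝕏` into a covering space are holomorphic** for the
induced structure (rigidity with target `ofCover`). [cite: Lin2011, (7.5.2.1) p.449, proof p.450] -/
theorem mdifferentiable_to_ofCover (hp : IsCoveringMap p) (hfin : ∀ x, (p ⁻¹' {x}).Finite)
    {Y : HolRS} (fY : Y ⟶ X) {g : Y.carrier → E} (hg : Continuous g) (h : p ∘ g = fY.toFun) :
    letI := IsLocalHomeomorph.comapChartedSpace ℂ hp.isLocalHomeomorph;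
    MDifferentiable 𝓘(ℂ, ℂ) 𝓘(ℂ, ℂ) g :=
  mdifferentiable_of_comp_eq fY (X.ofCoverHom hp hfin) hg h

omit [ConnectedSpace E] in
/-- Over a connected Riemann surface ONE finite fibre suffices: a covering map of `𝕏` with a finite
fibre over some point has all fibres finite (the number of sheets is locally constant; the tree's
`Literature.Topology.CoveringSpaces.finite_preimage_singleton_of_preconnectedSpace`), so `ofCover`
applies. [cite: Lin2011, (7.5.2.1) p.449] -/
theorem finite_fibre_of_finite_fibre (hp : IsCoveringMap p) {x₀ : X.carrier}
    (h₀ : (p ⁻¹' {x₀}).Finite) (x : X.carrier) : (p ⁻¹' {x}).Finite :=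
  Literature.Topology.CoveringSpaces.finite_preimage_singleton_of_preconnectedSpace hp h₀ x

end OfCover

end HolRS

end Literature.AnabelianGeometry.AbsoluteAnabelian
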